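import Summits.BirchSwinnertonDyer.BirchSwinnertonDyer.Theorems.SignedLowerHalvesSmallImageLowerHalfBothSignsRttLayerLawDepletedK
import Summits.BirchSwinnertonDyer.BirchSwinnertonDyer.Theorems.ResidualThetaTransportAtTwoResidualThetaMainConjectureAtTwoPollackPairKConstruction
import HarnessLib

/-!
# Route `SignedLowerHalves`, crux L `SmallImageLowerHalfBothSigns` (item stmt-BirchSwinnertonDyer-23599), line `rtt_w3` —
# ENG_T2 glue: the engine's conclusion for the partner `g` from AN_g (parts 1–3, LANDED) and ONE Selmer-side bound on the
# `λ`-index of the CONSTRUCTED signed function `L^ε_g ∈ 𝒪⟦T⟧` (Pollack Prop. 6.18 over `𝒪` at a cohomological period)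

Width seat `bsd-line-slh-p3-w3` g12 under LEAD `cruxlead-stmt-BirchSwinnertonDyer-23599` (cell `bsd-ssimc`); ROUTE-INDEPENDENT
helper (`--supports stmt-BirchSwinnertonDyer-23599`); THEOREMS ONLY — no definition, no named fact, no `sorry`; closes nothing;
BSD is not proved by any of this.

WHAT. The registered engine stub of line `rtt_w3` (v3 `stub_partnerLayerLambdaLower_ns`; v4 ENG_T2) concludes, for the
level-matched CM partner `g` (level `M`, `p ∤ M`, `a_p(g) = 0`, COHOMOLOGICAL plus period `Ω` along `ι`), a sign `ε`, an admissible
`S₀ ∌ p` and a bound `B` (there: `B = λ(X^ε_W) + Σ_{v∈S₀} δ_W^{(v)}`):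
`∃ n₀, ∀ n ≥ n₀` of the parity of `ε`, `λ_n(θ^{S₀}_n(g)^ι) ≤ deg ω_n^{−ε} + B`.
This file proves that conclusion from ONE hypothesis on the partner's Selmer side, stated on the signed function that the TREE
CONSTRUCTS (`ResidualThetaLayer.exists_isCongrModOmegaO_even/odd`: `L ∈ 𝒪⟦T⟧` with
`θ_n(g)^ι ≡ (−1)^{⌊n/2⌋+1} ω_n^{−ε} L (mod ω_n 𝒪⟦T⟧)` at every layer of the parity of `ε` — Pollack 2003 Prop. 6.18 over `𝒪`, any
prime, no named fact):

> (PSB) for every non-zero `L ∈ 𝒪⟦T⟧` satisfying those congruences there is an index `d` at which the Gauss norm of `L` is first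
> attained (its `λ`-invariant) with `d + Σ_{v∈S₀} p^{v_p(f_ℓ)}·λ(P_{g,ℓ}(ℓ⁻¹(X+1))) ≤ B`.

So ENG_T2 ⟸ (PSB) with `B = λ(X^ε_W) + Σδ_W`, and (PSB) is exactly the LEAD's seam (CENSUS-Klam2-g0 §2): (M3^≥) `λ(L^ε_g) ≤ λ(X^ε_g)`
(partner main conjecture, lower half) ∧ (M2) `λ(X^ε_g) + Σ_v δ_g^{(v)} = λ(X^ε_W) + Σ_v δ_W^{(v)}` (Hatley–Lei 2019 Thm 4.6) ∧ (GV 2.4 for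
`g`) `δ_g^{(v)} = p^{v_p(f_ℓ)}·λ(P_{g,ℓ}(ℓ⁻¹(X+1)))` — the analytic side (M4) being discharged here by AN_g, and the degenerate case
`L = 0` (where the congruences force `θ_n(g)^ι = 0`) by §1. Nothing about `X^ε_g` (the untyped carrier (M1)) appears.

* §1 `eq_zero_of_layerCongruence_zero` — norm language: `c·θ = ω_n·q` with `q` bounded, `deg θ < pⁿ` forces `θ = 0`
  (Claim A of `ResidualThetaLayer.supNorm_eq_and_layerLambda_eq_of_layerCongruence` with `s = 0`);
  `mazurTateElementK_map_eq_zero_of_isCongrModOmegaO_zero`.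
* §2 `isCongrModOmegaO_family_of_construction` — the tree's construction packaged as ONE family indexed by the layers of the
  parity of `ε`; `layerLambda_zero'`.
* §3 **`partnerLayerLambdaLower_of_partnerSelmerBound`** — ENG's conclusion for `g` from (PSB), every prime, both parities.

References: [Pollack2003] Prop. 6.18; [PollackWeston2011MT] §3.1, Thm. 4.1, Def. 2.1; [GreenbergVatsal2000] §2 Prop. (2.4);
[HatleyLei2019] Thm. 4.6; [Kobayashi2003] Thm. 1.2.
-/

set_option autoImplicit false
-- D-0017: single-problem summit, the namespace repeats the problem name by design.
set_option linter.dupNamespace false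
noncomputable section

open scoped Classical MatrixGroups ModularForm

open Polynomial NumberField IsDedekindDomain Literature.NumberTheory.EllipticCurves
  Literature.NumberTheory.EllipticCurves.ModularForms Literature.NumberTheory.EllipticCurves.GreenbergVatsal2000
  Literature.NumberTheory.IwasawaTheory Rat.HeightOneSpectrum
  Summit.BirchSwinnertonDyer.Rank1Residual.X2.EulerFactorInvariants
  Summit.BirchSwinnertonDyer.BirchSwinnertonDyer.Theorems.ThetaLayerLambdaCongruenceAtTwo
  Summit.BirchSwinnertonDyer.BirchSwinnertonDyer.Theorems.ResidualThetaLayer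
  Summit.BirchSwinnertonDyer.BirchSwinnertonDyer.Theorems.SmallImageRttOneSided

namespace Summit.BirchSwinnertonDyer.BirchSwinnertonDyer.Theorems.SmallImageRttLayerLawK

/-! ## §1 A congruence with `L = 0` forces `θ_n = 0` -/

section Zero

variable {K : Type*} [NormedField K] [IsUltrametricDist K]

/-- **`c·θ = ω·q` with `q` bounded and `deg θ < N` forces `θ = 0`** when `ω` has coefficient `1` in degree `N` and all other
coefficients of norm `≤ r < 1` (Claim A of the norm-language layer lemma with `s = 0`: comparing coefficients in degrees `N + k`
gives `sup ‖q_k‖ ≤ r · sup ‖q_k‖`, so `q = 0`). [cite: PollackWeston2011MT, §3.1] [cite: Pollack2003, Prop. 6.9] -/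
theorem eq_zero_of_layerCongruence_zero {N : ℕ} {r : ℝ} (hr : r < 1) {θ ω : K[X]} {q : PowerSeries K} {c : K}
    (hc : c ≠ 0) (hθ : ∀ j, N ≤ j → θ.coeff j = 0) (hωN : ω.coeff N = 1) (hω : ∀ j, j ≠ N → ‖ω.coeff j‖ ≤ r)
    (hq : ∃ B : ℝ, ∀ k, ‖PowerSeries.coeff k q‖ ≤ B)
    (hcong : PowerSeries.C c * (θ : PowerSeries K) = (ω : PowerSeries K) * q) : θ = 0 := by
  have hr0 : 0 ≤ r := by
    by_cases h : N = 0
    · exact (norm_nonneg _).trans (hω 1 (by omega))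
    · exact (norm_nonneg _).trans (hω 0 (by omega))
  obtain ⟨B, hB⟩ := hq
  have hbdd : BddAbove (Set.range fun k ↦ ‖PowerSeries.coeff k q‖) := ⟨B, by rintro _ ⟨k, rfl⟩; exact hB k⟩
  set t : ℝ := ⨆ k, ‖PowerSeries.coeff k q‖ with ht
  have hqt : ∀ k, ‖PowerSeries.coeff k q‖ ≤ t := fun k ↦ le_ciSup hbdd k
  have ht0 : 0 ≤ t := (norm_nonneg _).trans (hqt 0)
  -- `q_k = − Σ_{i ≠ N} ω_i q_{N+k−i}`, so `‖q_k‖ ≤ r t`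
  have hqk : ∀ k, ‖PowerSeries.coeff k q‖ ≤ r * t := by
    intro k
    have h1 := congrArg (PowerSeries.coeff (N + k)) hcong
    rw [PowerSeries.coeff_C_mul, Polynomial.coeff_coe, hθ (N + k) (Nat.le_add_right N k), mul_zero,
      coeff_coe_mul_eq_add_sum_erase ω q N k, hωN, one_mul] at h1
    have h2 := eq_neg_of_add_eq_zero_left h1.symm
    rw [h2, norm_neg]
    refine norm_sum_le_of_forall_le' (mul_nonneg hr0 ht0) fun x hx ↦ ?_
    rw [norm_mul]
    exact mul_le_mul (hω x.1 (fst_ne_of_mem_erase_antidiagonal hx)) (hqt x.2) (norm_nonneg _) hr0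
  have htle : t ≤ r * t := ciSup_le hqk
  have ht : t = 0 := by
    by_contra h
    have hpos : 0 < t := lt_of_le_of_ne ht0 (Ne.symm h)
    have : r * t < 1 * t := mul_lt_mul_of_pos_right hr hpos
    rw [one_mul] at this
    exact absurd htle (not_le.mpr this)
  have hq0 : q = 0 := PowerSeries.ext fun k ↦ by
    rw [map_zero]; exact norm_le_zero_iff.mp (by rw [← ht]; exact hqt k)
  rw [hq0, mul_zero] at hcong
  have hθ0 : (θ : PowerSeries K) = 0 := by
    rcases mul_eq_zero.mp hcong with h | h
    · have hc0 : c = 0 := by simpa using congrArg PowerSeries.constantCoeff h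
      exact absurd hc0 hc
    · exact h
  exact Polynomial.coe_injective K (by rw [hθ0, Polynomial.coe_zero])

end Zero

/-! ## §2 The constructed signed function as one family; small facts -/

section Family

variable {p : ℕ} [hp : Fact p.Prime] {M : ℕ} [NeZero M] (g : CuspForm (CongruenceSubgroup.Gamma0 M) 2)
  (ι : coeffField g →+* PadicAlgCl p) (Ω : ℂ)

omit [NeZero M] in
/-- **A congruence with the zero function kills the Mazur–Tate element**: if `θ_n(g)^ι ≡ ωm·ι(0) = 0 (mod ω_n)` in `𝒪⟦T⟧ ⊗ ℚ`
(`IsCongrModOmegaO` with `L = 0`), then `θ_n(g)^ι = 0` (`deg θ_n < pⁿ`; §1 with the modulus `ω_n`, whose non-leading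
coefficients have norm `≤ p⁻¹`). [cite: PollackWeston2011MT, §3.1] [cite: Pollack2003, Prop. 6.18] -/
theorem mazurTateElementK_map_eq_zero_of_isCongrModOmegaO_zero {n : ℕ} (ωm : PowerSeries (PadicAlgCl p))
    (hcong : IsCongrModOmegaO (Set.range ι) n ((mazurTateElementK g Ω p n).map ι)
      (ωm * iwasawaOToPowerSeries (Set.range ι) 0)) :
    (mazurTateElementK g Ω p n).map ι = 0 := by
  obtain ⟨m, q, hmq⟩ := hcong
  rw [map_zero, mul_zero, sub_zero] at hmq
  obtain ⟨hωN, hω⟩ := coeff_map_cyclotomicOmega_norm p n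
  have hc : ((p : PadicAlgCl p) ^ m) ≠ 0 := pow_ne_zero _ (by exact_mod_cast hp.out.ne_zero)
  have hθcoeff : ∀ j, p ^ n ≤ j → ((mazurTateElementK g Ω p n).map ι).coeff j = 0 := fun j hj ↦ by
    rw [coeff_map, coeff_mazurTateElementK_eq_zero g Ω p n hj, map_zero]
  have hq : ∃ B : ℝ, ∀ k, ‖PowerSeries.coeff k (iwasawaOToPowerSeries (Set.range ι) q)‖ ≤ B :=
    ⟨1, norm_coeff_iwasawaOToPowerSeries_le_one (Set.range ι) q⟩
  have hr : (p : ℝ)⁻¹ < 1 := inv_lt_one_of_one_lt₀ (by exact_mod_cast hp.out.one_lt)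
  exact eq_zero_of_layerCongruence_zero hr hc hθcoeff hωN hω hq hmq

/-- **The tree's construction as ONE family.** At a cohomological period, for `p ∤ M` and `a_p(g) = 0`, there is `L ∈ 𝒪⟦T⟧` with
`θ_n(g)^ι ≡ (−1)^{⌊n/2⌋+1} ω_n^{−ε}·L (mod ω_n 𝒪⟦T⟧)` at EVERY layer `n` of the parity of `ε` (`ε = 1`: `L = L⁻` from
`ResidualThetaLayer.exists_isCongrModOmegaO_even`, `n = 2m`; `ε = −1`: `L = L⁺` from `…_odd`, `n = 2m + 1`; `⌊n/2⌋ = m`).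
[cite: Pollack2003, Prop. 6.18] [cite: PollackWeston2011MT, Rem. 2.2] -/
theorem isCongrModOmegaO_family_of_construction (hnew : IsNewform0 g) (hΩ : IsCohomologicalPlusPeriod g ι Ω)
    (hpM : ¬ p ∣ M) (hap : cuspCoeff g p = 0) (ε : ℤˣ) :
    ∃ L : IwasawaAlgebraO (Set.range ι), ∀ n : ℕ, (Even n ↔ ε = 1) →
      IsCongrModOmegaO (Set.range ι) n ((mazurTateElementK g Ω p n).map ι)
        (((((-1) ^ (n / 2 + 1) * (if ε = 1 then cyclotomicOmegaMinus p n else cyclotomicOmegaPlus p n)).map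
            (Int.castRingHom (PadicAlgCl p)) : (PadicAlgCl p)[X]) : PowerSeries (PadicAlgCl p)) *
          iwasawaOToPowerSeries (Set.range ι) L) := by
  rcases Int.units_eq_one_or ε with rfl | rfl
  · obtain ⟨L, hL⟩ := exists_isCongrModOmegaO_even hnew hΩ hpM hap
    refine ⟨L, fun n hpar ↦ ?_⟩
    obtain ⟨m, rfl⟩ := hpar.mpr rfl
    simp only [if_true]
    rw [← two_mul, Nat.mul_div_cancel_left m two_pos]
    exact hL m
  · obtain ⟨L, hL⟩ := exists_isCongrModOmegaO_odd hnew hΩ hpM hap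
    refine ⟨L, fun n hpar ↦ ?_⟩
    have hne : (-1 : ℤˣ) ≠ 1 := by decide
    obtain ⟨m, rfl⟩ : Odd n := Nat.not_even_iff_odd.mp fun h ↦ hne (hpar.mp h)
    simp only [hne, if_false]
    rw [show (2 * m + 1) / 2 = m by omega]
    exact hL m

omit [NeZero M] in
/-- `layerLambda 0 = 0` (the least index attaining the sup norm `0`). [cite: PollackWeston2011MT, §3.1] -/
theorem layerLambda_zero' : layerLambda (0 : (PadicAlgCl p)[X]) = 0 := by
  rw [layerLambda_eq_iff, supNorm_zero, coeff_zero, norm_zero]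
  exact ⟨rfl, fun j hj ↦ absurd hj (Nat.not_lt_zero j)⟩

end Family

/-! ## §3 ENG's conclusion for the partner from the partner Selmer bound (PSB) -/

section Glue

variable {p : ℕ} [hp : Fact p.Prime] {M : ℕ} [NeZero M] (g : CuspForm (CongruenceSubgroup.Gamma0 M) 2)
  (ι : coeffField g →+* PadicAlgCl p) (Ω : ℂ)

/-- **ENG_T2 ⟸ AN_g ∧ (PSB).** For a newform `g` on `Γ₀(M)` with `p ∤ M`, `a_p(g) = 0`, an embedding `ι` and a COHOMOLOGICAL plus
period `Ω` (the partner clauses of ENG), a sign `ε`, a finite set `S₀` of places in the crux's spelling `(p) ∉ v`, and a bound `B`: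
IF every non-zero `L ∈ 𝒪⟦T⟧` carrying the congruences `θ_n(g)^ι ≡ (−1)^{⌊n/2⌋+1} ω_n^{−ε} L (mod ω_n)` at the layers of the
parity of `ε` admits a `λ`-index `d` (Gauss norm first attained at `d`) with
`d + Σ_{v∈S₀} p^{v_p(f_ℓ)}·λ(P_{g,ℓ}(ℓ⁻¹(X+1))) ≤ B` — the partner Selmer bound (PSB) = (M3^≥) ∧ (M2) ∧ (GV 2.4 for `g`) of the
LEAD's census with `B = λ(X^ε_W) + Σ_{v∈S₀} δ_W^{(v)}` — THEN ENG's conclusion holds for `g`: there is `n₀` with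
`λ_n(θ^{S₀}_n(g)^ι) ≤ deg ω_n^{−ε} + B` for every `n ≥ n₀` of the parity of `ε` (the `S₀`-depleted term VERBATIM as in Kan₂/ENG).
The signed function exists by the tree's construction (§2); if it vanishes the Mazur–Tate elements of that parity vanish (§1) and
the bound is trivial; otherwise AN_g (`eventually_layerLambda_depletedK_of_isCongrModOmegaO`) gives the EXACT value
`deg ω_n^{−ε} + d + Σ`. [cite: Pollack2003, Prop. 6.18] [cite: PollackWeston2011MT, §3.1 and Thm. 4.1]
[cite: GreenbergVatsal2000, §2 Prop. (2.4) and §1 (9)] [cite: HatleyLei2019, Thm. 4.6] -/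
theorem partnerLayerLambdaLower_of_partnerSelmerBound (hnew : IsNewform0 g) (hΩ : IsCohomologicalPlusPeriod g ι Ω)
    (hpM : ¬ p ∣ M) (hap : cuspCoeff g p = 0) (ε : ℤˣ)
    (S₀ : Finset (HeightOneSpectrum (𝓞 ℚ))) (hS₀ : ∀ v ∈ S₀, ((p : ℕ) : 𝓞 ℚ) ∉ v.asIdeal) (B : ℕ)
    (hPSB : ∀ L : IwasawaAlgebraO (Set.range ι), L ≠ 0 →
      (∀ n : ℕ, (Even n ↔ ε = 1) → IsCongrModOmegaO (Set.range ι) n ((mazurTateElementK g Ω p n).map ι)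
        (((((-1) ^ (n / 2 + 1) * (if ε = 1 then cyclotomicOmegaMinus p n else cyclotomicOmegaPlus p n)).map
            (Int.castRingHom (PadicAlgCl p)) : (PadicAlgCl p)[X]) : PowerSeries (PadicAlgCl p)) *
          iwasawaOToPowerSeries (Set.range ι) L)) →
      ∃ d : ℕ, (∀ k : ℕ, ‖PowerSeries.coeff k (iwasawaOToPowerSeries (Set.range ι) L)‖ ≤
          ‖PowerSeries.coeff d (iwasawaOToPowerSeries (Set.range ι) L)‖) ∧
        (∀ k : ℕ, k < d → ‖PowerSeries.coeff k (iwasawaOToPowerSeries (Set.range ι) L)‖ <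
          ‖PowerSeries.coeff d (iwasawaOToPowerSeries (Set.range ι) L)‖) ∧
        d + ∑ v ∈ S₀, p ^ (frobeniusExponent p (natGenerator v : ℤ_[p])).valuation *
          layerLambda ((1 - C (embCoeff g ι (natGenerator v)) * X +
            (if natGenerator v ∣ M then 0 else C (natGenerator v : PadicAlgCl p)) * X ^ 2).comp
              (C ((natGenerator v : PadicAlgCl p)⁻¹) * (X + 1))) ≤ B) :
    ∃ n₀ : ℕ, ∀ n ≥ n₀, (Even n ↔ ε = 1) →
      layerLambda (((mazurTateElementK g Ω p n).map ι *
          ∏ v ∈ S₀, (1 - C (embCoeff g ι (natGenerator v)) * X +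
            (if natGenerator v ∣ M then 0 else C (natGenerator v : PadicAlgCl p)) * X ^ 2).comp
              (C ((natGenerator v : PadicAlgCl p)⁻¹) *
                (X + 1) ^ (PadicInt.toZModPow n (-(frobeniusExponent p (natGenerator v : ℤ_[p])))).val)) %ₘ
          ((X + 1) ^ p ^ n - 1)) ≤
        (if ε = 1 then cyclotomicOmegaMinus p n else cyclotomicOmegaPlus p n).natDegree + B := by
  obtain ⟨L, hL⟩ := isCongrModOmegaO_family_of_construction g ι Ω hnew hΩ hpM hap ε
  by_cases hL0 : L = 0
  · -- degenerate case: all Mazur–Tate elements of this parity vanish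
    refine ⟨0, fun n _ hpar ↦ ?_⟩
    have hθ : (mazurTateElementK g Ω p n).map ι = 0 :=
      mazurTateElementK_map_eq_zero_of_isCongrModOmegaO_zero g ι Ω _ (by rw [← hL0]; exact hL n hpar)
    simp only [hθ, zero_mul, zero_modByMonic, layerLambda_zero', zero_le]
  · obtain ⟨d, hd1, hd2, hbound⟩ := hPSB L hL0 hL
    have hs : 0 < ‖PowerSeries.coeff d (iwasawaOToPowerSeries (Set.range ι) L)‖ := by
      obtain ⟨k, hk⟩ : ∃ k, PowerSeries.coeff k (iwasawaOToPowerSeries (Set.range ι) L) ≠ 0 := by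
        by_contra h
        push Not at h
        apply hL0
        apply iwasawaOToPowerSeries_injective (Set.range ι)
        rw [map_zero]
        exact PowerSeries.ext fun k ↦ by rw [h k, map_zero]
      exact (norm_pos_iff.mpr hk).trans_le (hd1 k)
    obtain ⟨n₀, hn₀⟩ := eventually_layerLambda_depletedK_of_isCongrModOmegaO g ι Ω hnew ε hL hs hd1 hd2 S₀ hS₀
    refine ⟨n₀, fun n hn hpar ↦ ?_⟩
    rw [(hn₀ n hn hpar).2]
    omega

end Glue

end Summit.BirchSwinnertonDyer.BirchSwinnertonDyer.Theorems.SmallImageRttLayerLawK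

end
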